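import Literature.Probability.Percolation.ArmSeparationRawGood
import Literature.Probability.Percolation.ArmSeparationFrameBelow
import Literature.Probability.Percolation.ArmSeparationFenceBoundAt
import Literature.Probability.Percolation.TriLowestCrossingProb
import HarnessLib

/-!
# The raw good event of a term explored from ABOVE, and its failure bound

Topic `Literature/Probability/Percolation`; family `crit-perc` / near-critical percolation on `𝕋`.
A brick of the near-critical arm-separation theorem for four arms in the ADJACENT colour
arrangement (P. Nolin, EJP 13 (2008), Thm. 11, `j = 4`, `σ = BBWW` [arXiv 0711.4948: Thm. 10];
the last missing input `hsepAdj` of `Werner2009_lemma63_of_altSeparation_of_adjSeparation`).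

The second canonical family of exits for arms of the same colour landing on different sides
(`ArmSeparationFrameBelow.lean`): the terms of the exploration from above, `lowestSeq` of the
flipped domain `(trapDomain M).flip`. This file transfers to them the raw good event and the
failure bound of `ArmSeparationRawGood.lean`:

* `TrapNoRSWL L z k₀ K ω` — the "no good configuration off the frozen set `L`" event for a general
  frozen finite set `L`; `determinedBy_trapNoRSWL` (sites of the wide annuli off `L`),
  `trapNoRSWL_subset`;
* `TrapRawOKUp M d z k ω` — some configuration agreeing with `ω` off `flip.lower d z` lies in
  `trapRSW₃ z k`; `TrapRawOKUp.exists_fence_below_gen`, `outer_ring`, `inner_ring`;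
* `TrapSeqFailRawUp M u k₀ K ω` — the `u`-th term from above exists and is raw-bad on all scales;
  `real_trapSeqFailRawUp_le_at` — `P_p(TrapSeqFailRawUp) ≤ P_p(term u exists) · (1 - c_F² c_E c_I)^K`
  (decoupling on `flip.lower d z` via `JDomain.determinedBy_lowestSeq_eq` for the flipped domain,
  `flip_cutProp`, `flip_dualProp`); `measurableSet_trapSeqFailRawUp`.

Everything here is proved; no named facts are introduced.

## References

* P. Nolin, Near-critical percolation in two dimensions, *Electron. J. Probab.* 13 (2008), §4.4,
  proof of Lemma 15 (arXiv 0711.4948: Lemma 14) [Nolin2008].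
* H. Kesten, *Percolation theory for mathematicians* (1982), §2.3 (highest crosscuts)
  [KestenPTM1982]; H. Kesten, Scaling relations for 2D-percolation, *CMP* 109 (1987), Lemma 2
  (eq. (2.26)) [Kesten1987].
-/

noncomputable section

open MeasureTheory ProbabilityTheory Set

namespace Literature.Probability.Percolation

open LatticeModels

/-! ### No good configuration off a general frozen set -/

/-- **No configuration agreeing with `ω` off the frozen set `L` lies in any `trapRSW₃ z k_j`.** [cite: Nolin2008, §4.4 Lemma 15 (proof) (arXiv 0711.4948: Lemma 14)] -/
def TrapNoRSWL (L : Finset (Site 2)) (z : Site 2) (k₀ K : ℕ) (ω : SiteConfig (Site 2)) : Prop :=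
  ∀ j < K, ∀ ω' : SiteConfig (Site 2), (∀ v, v ∉ L → (v ∈ ω' ↔ v ∈ ω)) → ω' ∉ trapRSW₃ z (trapScale k₀ j)

/-- `TrapNoRSWL` is determined by the sites of the wide annuli that are off `L`. [folklore] -/
theorem determinedBy_trapNoRSWL (L : Finset (Site 2)) (z : Site 2) (k₀ K : ℕ) :
    DeterminedBy {ω | TrapNoRSWL L z k₀ K ω} ↑(trapScalesFinset₂ z k₀ K \ L) := by
  classical
  rw [determinedBy_iff]
  suffices h : ∀ ω₁ ω₂ : Set (Site 2),
      ω₁ ∩ ↑(trapScalesFinset₂ z k₀ K \ L) = ω₂ ∩ ↑(trapScalesFinset₂ z k₀ K \ L) →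
      TrapNoRSWL L z k₀ K ω₁ → TrapNoRSWL L z k₀ K ω₂ from
    fun ω₁ ω₂ hω => ⟨h ω₁ ω₂ hω, h ω₂ ω₁ hω.symm⟩
  intro ω₁ ω₂ hω h j hj ω' hagree hω'
  set A := triSqAnnulusFinset z (trapScale k₀ j) (31 * trapScale k₀ j) with hA
  set ω'' : Set (Site 2) := {v | if v ∈ A then v ∈ ω' else v ∈ ω₁} with hω''
  have hA' : ω'' ∩ ↑A = ω' ∩ ↑A := by
    ext v
    simp only [hω'', Set.mem_inter_iff, Set.mem_setOf_eq, Finset.mem_coe]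
    constructor
    · rintro ⟨h1, h2⟩; rw [if_pos h2] at h1; exact ⟨h1, h2⟩
    · rintro ⟨h1, h2⟩; rw [if_pos h2]; exact ⟨h1, h2⟩
  have hmem : ω'' ∈ trapRSW₃ z (trapScale k₀ j) :=
    ((determinedBy_iff _ _).1 (determinedBy_trapRSW₃ z (trapScale k₀ j)) ω'' ω' hA').2 hω'
  refine h j hj ω'' (fun v hv => ?_) hmem
  simp only [hω'', Set.mem_setOf_eq]
  split_ifs with hvA
  · rw [hagree v hv]
    have : v ∈ (↑(trapScalesFinset₂ z k₀ K \ L) : Set (Site 2)) := by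
      rw [Finset.coe_sdiff]
      refine ⟨Finset.mem_coe.2 ?_, hv⟩
      rw [trapScalesFinset₂, Finset.mem_biUnion]
      exact ⟨j, Finset.mem_range.2 hj, hvA⟩
    have key := Set.ext_iff.1 hω v
    simp only [Set.mem_inter_iff] at key
    constructor
    · intro h2; exact (key.2 ⟨h2, this⟩).1
    · intro h1; exact (key.1 ⟨h1, this⟩).1
  · exact Iff.rfl

/-- `TrapNoRSWL ⊆ ⋂_j (trapRSW₃ z k_j)ᶜ` (take `ω' = ω`). [folklore] -/
theorem trapNoRSWL_subset (L : Finset (Site 2)) (z : Site 2) (k₀ K : ℕ) :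
    {ω | TrapNoRSWL L z k₀ K ω} ⊆ ⋂ j ∈ Finset.range K, (trapRSW₃ z (trapScale k₀ j))ᶜ := by
  intro ω hω
  simp only [Set.mem_iInter, Set.mem_compl_iff]
  intro j hj
  exact hω j (Finset.mem_range.1 hj) ω (fun v _ => Iff.rfl)

/-! ### The raw good event of a term from above -/

/-- **Raw success of the fence of a term `d` explored from above (tip `z`) at scale `k`**: some
configuration agreeing with `ω` off `flip.lower d z` lies in `trapRSW₃ z k`. [cite: Nolin2008, §4.4 Lemma 15 (proof) (arXiv 0711.4948: Lemma 14)] -/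
def TrapRawOKUp (M : ℕ) (d : Finset (Site 2)) (z : Site 2) (k : ℕ) (ω : SiteConfig (Site 2)) : Prop :=
  ∃ ω' : SiteConfig (Site 2), (∀ v, v ∉ (trapDomain M).flip.lower d z → (v ∈ ω' ↔ v ∈ ω)) ∧ ω' ∈ trapRSW₃ z k

namespace TrapRawOKUp

variable {M k : ℕ} {d : Finset (Site 2)} {z : Site 2} {ω : SiteConfig (Site 2)}

/-- **The mirrored fence with a stopping set** from raw success (`1 ≤ k`, `2k + 1 ≤ M`,
`-2M < z₁ < 0`). [cite: Nolin2008, §4.4 Lemma 15 (proof) (arXiv 0711.4948: Lemma 14)] [cite: Kesten1987, Lemma 2] -/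
theorem exists_fence_below_gen (h : TrapRawOKUp M d z k ω) (hk : 1 ≤ k) (hkM : 2 * (k : ℤ) + 1 ≤ M)
    (hd : (trapDomain M).flip.IsCrossing d z) (hz0 : z 1 < 0) (hzB : -(2 * (M : ℤ)) < z 1)
    {S : Set (Site 2)} (hdS : (↑d : Set (Site 2)) ⊆ S) (hSn : ∀ v ∈ S, triNorm v ≤ 2 * M) :
    ∃ m : Site 2, OpenVCrossThrough (triStrip (z 0 + k) (z 1 - 2 * k) k k) (z 1 - 2 * k) (z 1 - k) ω m ∧
      ∃ q ∈ S, ∃ p : Site 2, triGraph.Adj q p ∧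
        PathIn triGraph ((trapFrameZoneBelow M z k ∩
          {v | (triNorm v ≤ 2 * M → v ∈ (trapDomain M).flip.above d z) ∧ (2 * (M : ℤ) < triNorm v → v 1 < z 1)}) ∩
            ω ∩ Sᶜ) p m := by
  obtain ⟨ω', hagree, hω'⟩ := h
  exact trap_exists_fence_below_gen hk hkM hd hz0 hzB hagree hω'.1.1.1 hdS hSn

/-- **Outer exclusion** from raw success (from above): no open path off `flip.lower d z` from the
`17k`-box about `z` to outside the `31k`-box (`1 ≤ k`). [cite: Nolin2008, §4.4 Lemma 15 (proof) (arXiv 0711.4948: Lemma 14)] -/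
theorem outer_ring (h : TrapRawOKUp M d z k ω) (hk : 1 ≤ k) {s t : Site 2}
    (hs : z 0 - 17 * k ≤ s 0 ∧ s 0 ≤ z 0 + 17 * k ∧ z 1 - 17 * k ≤ s 1 ∧ s 1 ≤ z 1 + 17 * k)
    (ht : t 0 ≤ z 0 - 31 * k ∨ z 0 + 31 * k ≤ t 0 ∨ t 1 ≤ z 1 - 31 * k ∨ z 1 + 31 * k ≤ t 1) :
    ¬ PathIn triGraph ((↑((trapDomain M).flip.lower d z) : Set (Site 2))ᶜ ∩ ω) s t := by
  obtain ⟨ω', hagree, hω'⟩ := h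
  refine not_pathIn_of_closed_ring hk (L := ↑((trapDomain M).flip.lower d z)) (fun v hv => hagree v ?_) ?_ subset_rfl hs ht
  · exact fun h => hv (Finset.mem_coe.2 h)
  · have : ω'ᶜ ∈ triRingAt z k := hω'.1.2
    exact this

/-- **Inner exclusion** from raw success (from above): no open path off `flip.lower d z` from the
`3k`-box about `z` to outside the `7k`-box (`1 ≤ k`). [cite: Nolin2008, §4.4 Lemma 15 (proof) (arXiv 0711.4948: Lemma 14)] -/
theorem inner_ring (h : TrapRawOKUp M d z k ω) (hk : 1 ≤ k) {s t : Site 2}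
    (hs : z 0 - 3 * k ≤ s 0 ∧ s 0 ≤ z 0 + 3 * k ∧ z 1 - 3 * k ≤ s 1 ∧ s 1 ≤ z 1 + 3 * k)
    (ht : t 0 ≤ z 0 - 7 * k ∨ z 0 + 7 * k ≤ t 0 ∨ t 1 ≤ z 1 - 7 * k ∨ z 1 + 7 * k ≤ t 1) :
    ¬ PathIn triGraph ((↑((trapDomain M).flip.lower d z) : Set (Site 2))ᶜ ∩ ω) s t := by
  obtain ⟨ω', hagree, hω'⟩ := h
  refine not_pathIn_of_closed_innerRing hk (L := ↑((trapDomain M).flip.lower d z)) (fun v hv => hagree v ?_) ?_ subset_rfl hs ht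
  · exact fun h => hv (Finset.mem_coe.2 h)
  · have : ω'ᶜ ∈ triInnerRingAt z k := hω'.2
    exact this

/-- **Protection from below** from raw success (from above): no closed path of the trapezoid from
a bottom-type boundary site in the `8k`-box about `z` to outside the `16k`-box (`1 ≤ k`, `d` a
crossing of the flipped domain, open). [cite: Nolin2008, §4.4 Lemma 15 (proof) (arXiv 0711.4948: Lemma 14)] -/
theorem no_escape_below (h : TrapRawOKUp M d z k ω) (hk : 1 ≤ k) (hd : (trapDomain M).flip.IsCrossing d z)
    (hdω : (↑d : Set (Site 2)) ⊆ ω) {q t : Site 2} (hq : q ∈ (trapDomain M).Bt ∪ (trapDomain M).Jbelow z)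
    (hqin : z 0 - 8 * k ≤ q 0 ∧ q 0 ≤ z 0 + 8 * k ∧ z 1 - 8 * k ≤ q 1 ∧ q 1 ≤ z 1 + 8 * k)
    (ht : t 0 ≤ z 0 - 16 * k ∨ z 0 + 16 * k ≤ t 0 ∨ t 1 ≤ z 1 - 16 * k ∨ z 1 + 16 * k ≤ t 1) :
    ¬ PathIn triGraph ((↑(trapD M) : Set (Site 2)) ∩ ωᶜ) q t := by
  obtain ⟨ω', hagree, hω'⟩ := h
  intro hpath
  refine trap_no_closed_escape_below (k := 8 * k) (by omega) hd hdω hagree hω'.1.1.2 hq ?_ ?_ hpath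
  · push_cast; omega
  · push_cast; omega

end TrapRawOKUp

/-! ### Raw failure of a term from above and its probability -/

/-- **Raw failure of the `u`-th term from above**: the term exists and is raw-bad on all the
scales `k_j = k₀ · 32^j`, `j < K`. [cite: Nolin2008, §4.4 Lemma 15 (proof) (arXiv 0711.4948: Lemma 14)] -/
def TrapSeqFailRawUp (M u k₀ K : ℕ) (ω : SiteConfig (Site 2)) : Prop :=
  ∃ d z, (trapDomain M).flip.lowestSeq ω u = some (d, z) ∧ ∀ j < K, ¬ TrapRawOKUp M d z (trapScale k₀ j) ω

/-- Raw failure from above is `TrapNoRSWL` for the frozen set `flip.lower d z`. [folklore] -/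
theorem trapNoRSWL_of_failRawUp {M k₀ K : ℕ} {d : Finset (Site 2)} {z : Site 2} {ω : SiteConfig (Site 2)}
    (hfail : ∀ j < K, ¬ TrapRawOKUp M d z (trapScale k₀ j) ω) : TrapNoRSWL ((trapDomain M).flip.lower d z) z k₀ K ω :=
  fun j hj ω' hagree hω' => hfail j hj ⟨ω', hagree, hω'⟩

/-- **On the complement of raw failure every term from above is raw-good on some scale.** [folklore] -/
theorem exists_trapRawOKUp_of_not_fail {M u k₀ K : ℕ} {d : Finset (Site 2)} {z : Site 2}
    {ω : SiteConfig (Site 2)} (h : ¬ TrapSeqFailRawUp M u k₀ K ω)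
    (hu : (trapDomain M).flip.lowestSeq ω u = some (d, z)) : ∃ j < K, TrapRawOKUp M d z (trapScale k₀ j) ω := by
  by_contra hno
  push Not at hno
  exact h ⟨d, z, hu, fun j hj => hno j hj⟩

/-- Every term of the exploration from above is a pair of `trapPairs M`. [folklore] -/
theorem mem_trapPairs_of_flip_lowestSeq {M u : ℕ} {ω : Set (Site 2)} {d : Finset (Site 2)} {z : Site 2}
    (h : (trapDomain M).flip.lowestSeq ω u = some (d, z)) : (d, z) ∈ trapPairs M := by
  have hd := (JDomain.flip_isCrossing_iff _).1 (JDomain.isCrossing_of_lowestSeq h).1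
  rw [trapPairs, Finset.mem_product, Finset.mem_powerset]
  exact ⟨hd.subset, hd.tip_mem_J⟩

/-- **Probability of raw failure of the `u`-th term from above at density `p`**:
`P_p(TrapSeqFailRawUp) ≤ P_p(term u exists) · (1 - c_F² c_E c_I)^K`. [cite: Nolin2008, §4.4 Lemma 15 (proof) (arXiv 0711.4948: Lemma 14)] [cite: Kesten1987, Lemma 2 (eq. (2.26))] -/
theorem real_trapSeqFailRawUp_le_at (p : unitInterval) {cF cE cI : ℝ} (hcF : 0 < cF) (hcF1 : cF ≤ 1) (hcE : 0 ≤ cE)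
    (hcE1 : cE ≤ 1) (hcI : 0 ≤ cI) (hcI1 : cI ≤ 1) {M : ℕ}
    (hF : ∀ (z : Site 2) (k : ℕ), 1 ≤ k → k < M → cF ≤ (triSitePercolation p).real (triFrameAt z k))
    (hEr : ∀ (z : Site 2) (k : ℕ), 1 ≤ k → 32 * k < M → cE ≤ (triSitePercolation p).real (compl ⁻¹' triRingAt z k))
    (hIr : ∀ (z : Site 2) (k : ℕ), 1 ≤ k → 32 * k < M → cI ≤ (triSitePercolation p).real (compl ⁻¹' triInnerRingAt z k))
    {u k₀ K : ℕ} (hM : 1 ≤ M) (hk₀ : 1 ≤ k₀) (hKM : ∀ j < K, 32 * (trapScale k₀ j : ℤ) + 1 ≤ M) :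
    (triSitePercolation p).real {ω | TrapSeqFailRawUp M u k₀ K ω} ≤
      (triSitePercolation p).real {ω | (trapDomain M).flip.lowestSeq ω u ≠ none} * (1 - cF ^ 2 * cE * cI) ^ K := by
  classical
  have hcut : (trapDomain M).flip.CutProp := JDomain.flip_cutProp (trapDomain_cutProp M)
  have hdual : (trapDomain M).flip.DualProp := JDomain.flip_dualProp (trapDomain_dualProp hM)
  have hKS : ∀ j < K, 8 * trapScale k₀ j < M := fun j hj => by have := hKM j hj; omega
  have hKS' : ∀ j < K, trapScale k₀ j < (M - 1) / 32 + 1 := fun j hj => by have := hKM j hj; omega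
  have hEr' : ∀ (z : Site 2) (k : ℕ), 1 ≤ k → k < (M - 1) / 32 + 1 → cE ≤ (triSitePercolation p).real (compl ⁻¹' triRingAt z k) :=
    fun z k hk hkS => hEr z k hk (by omega)
  have hIr' : ∀ (z : Site 2) (k : ℕ), 1 ≤ k → k < (M - 1) / 32 + 1 → cI ≤ (triSitePercolation p).real (compl ⁻¹' triInnerRingAt z k) :=
    fun z k hk hkS => hIr z k hk (by omega)
  set μ := triSitePercolation p with hμ
  set E : Finset (Site 2) × Site 2 → Set (SiteConfig (Site 2)) :=
    fun q => {ω | (trapDomain M).flip.lowestSeq ω u = some q} with hE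
  have hsub : {ω | TrapSeqFailRawUp M u k₀ K ω} ⊆
      ⋃ q ∈ trapPairs M, (E q ∩ {ω | TrapNoRSWL ((trapDomain M).flip.lower q.1 q.2) q.2 k₀ K ω}) := by
    rintro ω ⟨d, z, h, hfail⟩
    simp only [Set.mem_iUnion, Set.mem_inter_iff, Set.mem_setOf_eq]
    exact ⟨(d, z), mem_trapPairs_of_flip_lowestSeq h, h, trapNoRSWL_of_failRawUp hfail⟩
  have hterm : ∀ q ∈ trapPairs M, μ.real (E q ∩ {ω | TrapNoRSWL ((trapDomain M).flip.lower q.1 q.2) q.2 k₀ K ω}) ≤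
      μ.real (E q) * (1 - cF ^ 2 * cE * cI) ^ K := by
    rintro ⟨d, z⟩ -
    have hEdet : DeterminedBy (E (d, z)) ↑((trapDomain M).flip.lower d z) :=
      JDomain.determinedBy_lowestSeq_eq hcut hdual u d z
    have hNdet := determinedBy_trapNoRSWL ((trapDomain M).flip.lower d z) z k₀ K
    have hdisj : Disjoint ((trapDomain M).flip.lower d z) (trapScalesFinset₂ z k₀ K \ (trapDomain M).flip.lower d z) :=
      Finset.disjoint_sdiff
    rw [hμ]
    unfold triSitePercolation
    rw [sitePercolation_real_inter_of_disjoint p hEdet hNdet hdisj]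
    refine mul_le_mul_of_nonneg_left ?_ measureReal_nonneg
    have h1 := (real_iInter_compl_trapRSW₃_le_at p hcF hcE hcI hF hEr' hIr' z hk₀ K hKS hKS').1
    unfold triSitePercolation at h1
    exact (measureReal_mono (trapNoRSWL_subset _ z k₀ K)).trans h1
  have hmeas : ∀ q ∈ trapPairs M, MeasurableSet (E q) := fun q _ =>
    (JDomain.determinedBy_lowestSeq_eq hcut hdual u q.1 q.2).measurableSet_of_finset
  have hdisjE : (↑(trapPairs M) : Set (Finset (Site 2) × Site 2)).PairwiseDisjoint E := fun q _ q' _ hqq' =>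
    JDomain.disjoint_setOf_lowestSeq_eq hqq'
  have hunion : μ.real (⋃ q ∈ trapPairs M, E q) ≤ μ.real {ω | (trapDomain M).flip.lowestSeq ω u ≠ none} := by
    refine measureReal_mono ?_
    intro ω hω
    simp only [Set.mem_iUnion, Set.mem_setOf_eq] at hω ⊢
    obtain ⟨q, -, hq⟩ := hω
    rw [hq]; exact Option.some_ne_none q
  have h0 : 0 ≤ 1 - cF ^ 2 * cE * cI := by
    have h1 : cF ^ 2 ≤ 1 := pow_le_one₀ hcF.le hcF1
    have h2 : cF ^ 2 * cE * cI ≤ 1 := by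
      calc cF ^ 2 * cE * cI ≤ 1 * 1 * 1 := by gcongr
        _ = 1 := by ring
    linarith
  calc μ.real {ω | TrapSeqFailRawUp M u k₀ K ω}
      ≤ μ.real (⋃ q ∈ trapPairs M, (E q ∩ {ω | TrapNoRSWL ((trapDomain M).flip.lower q.1 q.2) q.2 k₀ K ω})) :=
        measureReal_mono hsub (measure_ne_top _ _)
    _ ≤ ∑ q ∈ trapPairs M, μ.real (E q ∩ {ω | TrapNoRSWL ((trapDomain M).flip.lower q.1 q.2) q.2 k₀ K ω}) :=
        measureReal_biUnion_finset_le _ _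
    _ ≤ ∑ q ∈ trapPairs M, μ.real (E q) * (1 - cF ^ 2 * cE * cI) ^ K := Finset.sum_le_sum hterm
    _ = (∑ q ∈ trapPairs M, μ.real (E q)) * (1 - cF ^ 2 * cE * cI) ^ K := (Finset.sum_mul _ _ _).symm
    _ = μ.real (⋃ q ∈ trapPairs M, E q) * (1 - cF ^ 2 * cE * cI) ^ K := by rw [measureReal_biUnion_finset hdisjE hmeas]
    _ ≤ μ.real {ω | (trapDomain M).flip.lowestSeq ω u ≠ none} * (1 - cF ^ 2 * cE * cI) ^ K :=
        mul_le_mul_of_nonneg_right hunion (pow_nonneg h0 K)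

/-- `{TrapSeqFailRawUp}` is measurable. [folklore] -/
theorem measurableSet_trapSeqFailRawUp (M u k₀ K : ℕ) (hM : 1 ≤ M) :
    MeasurableSet {ω : SiteConfig (Site 2) | TrapSeqFailRawUp M u k₀ K ω} := by
  classical
  have hcut : (trapDomain M).flip.CutProp := JDomain.flip_cutProp (trapDomain_cutProp M)
  have hdual : (trapDomain M).flip.DualProp := JDomain.flip_dualProp (trapDomain_dualProp hM)
  have heq : {ω : SiteConfig (Site 2) | TrapSeqFailRawUp M u k₀ K ω} =
      ⋃ q ∈ trapPairs M, ({ω | (trapDomain M).flip.lowestSeq ω u = some q} ∩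
        {ω | TrapNoRSWL ((trapDomain M).flip.lower q.1 q.2) q.2 k₀ K ω}) := by
    ext ω
    simp only [Set.mem_setOf_eq, Set.mem_iUnion, Set.mem_inter_iff, exists_prop]
    constructor
    · rintro ⟨d, z, h, hfail⟩
      exact ⟨(d, z), mem_trapPairs_of_flip_lowestSeq h, h, trapNoRSWL_of_failRawUp hfail⟩
    · rintro ⟨⟨d, z⟩, -, h, hno⟩
      exact ⟨d, z, h, fun j hj ⟨ω', hagree, hω'⟩ => hno j hj ω' hagree hω'⟩
  rw [heq]
  refine MeasurableSet.biUnion (Finset.countable_toSet _) fun q _ => ?_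
  exact ((JDomain.determinedBy_lowestSeq_eq hcut hdual u q.1 q.2).measurableSet_of_finset).inter
    (determinedBy_trapNoRSWL _ q.2 k₀ K).measurableSet_of_finset

/-! ### The exploration from above stops -/

/-- The crossing event of the flipped trapezoid domain is contained in the crossing event of the
trapezoid (a crossing joins its inner-side site to its tip inside itself). [folklore] -/
theorem flip_crossEvent_subset_trapCrossEvent (M : ℕ) : (trapDomain M).flip.crossEvent ⊆ trapCrossEvent M := by
  rintro ω ⟨c, z, hc, hcω⟩
  have hc' := (JDomain.flip_isCrossing_iff _).1 hc
  obtain ⟨f, hfc, hfI⟩ := hc'.exists_start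
  exact ⟨f, hfI, z, hc'.tip_mem_J, (hc'.conn f hfc z hc'.tip_mem).mono fun v hv =>
    ⟨Finset.mem_coe.2 (hc'.subset (Finset.mem_coe.1 hv)), hcω hv⟩⟩

/-- **The exploration from above stops**: at density `p`, the `u`-th term from above exists with
probability at most `(1 - c₄)^{u+1}` (`u + 1` disjoint open crossings of the trapezoid, blocked by a
closed vertical crossing of probability `≥ c₄`). [cite: Nolin2008, §4.4 Lemma 15 (proof) (arXiv 0711.4948: Lemma 14)] -/
theorem real_flip_lowestSeq_ne_none_le_at (p : unitInterval) {c₄ : ℝ} {M : ℕ} (hM : 3 ≤ M)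
    (hc₄ : c₄ ≤ triLRCrossingProb (unitInterval.symm p) (4 * (M - 1)) (M - 1)) (u : ℕ) :
    (triSitePercolation p).real {ω | (trapDomain M).flip.lowestSeq ω u ≠ none} ≤ (1 - c₄) ^ (u + 1) := by
  have hcut : (trapDomain M).flip.CutProp := JDomain.flip_cutProp (trapDomain_cutProp M)
  have h1 := JDomain.real_lowestSeq_ne_none_le_pow hcut p u
  have h2 : (sitePercolation (Site 2) p).real (trapDomain M).flip.crossEvent ≤ 1 - c₄ := by
    have h3 := real_trapCrossEvent_le_at p hM hc₄
    unfold triSitePercolation at h3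
    exact (measureReal_mono (flip_crossEvent_subset_trapCrossEvent M)).trans h3
  unfold triSitePercolation
  exact h1.trans (pow_le_pow_left₀ measureReal_nonneg h2 _)

end Literature.Probability.Percolation
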